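import Summits.ValiantsHypothesis.ValiantsHypothesis.Theses.DecompCycle1
import Summits.ValiantsHypothesis.ValiantsHypothesis.Theorems.OrderedCountWindowBalancing
import HarnessLib

/-!
# DecompCycle1 · `PerNotSumOrderedId` holds (closes the aside item stmt-ValiantsHypothesis-26003)

`DecompCycle1.PerNotSumOrderedId` (`∀ c, ∃ n, ¬ IsSumOrdered ℂ n n (n ^ c + c)`: for every `c`, some
`per_n` is not a sum of `n` ordered set-multilinear ABPs, each in its own block order, of total width
`≤ n^c + c`) is the `t = id` instance of the support-size dial `A_t = OrderedCountWindow.PerNotSumOrdered t`,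
which `Theorems/OrderedCountWindowBalancing.lean` proves for EVERY `t`
(`OrderedCountWindow.perNotSumOrdered_all'`, via the alphabet-2 pair reservoir
`Theorems/OrderedCountWindow{SegmentRank,Pairs,Reservoir,Balancing}.lean`).

Context only for the route (LESSON 6 / critic R2): the item is an `aside` of
`route-ValiantsHypothesis-DecompCycle1`; it does not feed `closes` and says nothing about crux 23661
`PerNotSmVP` (unordered smABPs) — the determinant satisfies the same statement.
[cite: ArvindRaja2016, §7 Remark 11; ChatterjeeKushSarafShpilka2024, Thm 3]

This module imports the route file, so the gate records the close without a `_holds` link there.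
-/

namespace Summit.ValiantsHypothesis.ValiantsHypothesis.Theorems.DecompCycle1PerNotSumOrderedId

open Summit.ValiantsHypothesis.ValiantsHypothesis.Theorems.OrderedCountWindow

/-- `A_id`: closes `DecompCycle1.PerNotSumOrderedId`. [cite: ChatterjeeKushSarafShpilka2024, Thm 3
(method); ArvindRaja2016, §7 Remark 11 (question)] -/
theorem perNotSumOrderedId_holds :
    Summit.ValiantsHypothesis.ValiantsHypothesis.Theses.DecompCycle1.PerNotSumOrderedId := by
  intro c
  obtain ⟨n, hn⟩ := perNotSumOrdered_all' id c
  exact ⟨n, hn⟩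

end Summit.ValiantsHypothesis.ValiantsHypothesis.Theorems.DecompCycle1PerNotSumOrderedId
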